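import Summits.HodgeConjecture.HodgeConjecture.Theorems.F0P3cStCharTSJetDatumWeylDock          -- ★ p853647 (O1)-D: Weyl flip `unipotentModel_apply_weylConj_eq`, open fixer `exists_isOpen_forall_twist_unipotentModel_char_apply_eq_cm`
import Summits.HodgeConjecture.HodgeConjecture.Theorems.F0P3U3PrincipalSeriesJacquetClosedCell   -- ★ (C) `evalJacquetKer`, `mem_evalJacquetKer_iff` (the open-cell part `ℓ`)
import Summits.HodgeConjecture.HodgeConjecture.Theorems.F0P2nBorelCharactersUnipotent          -- ★ `deltaChar_cmBorel_eq_one` (`δ_B|_N = 1`)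
import Summits.HodgeConjecture.HodgeConjecture.Theorems.F0P3cStCharTSK2PiTwoSelfExtSplitSentence  -- ★ 40″ §0 `exists_representation_unipotentModel_jet`
import Summits.HodgeConjecture.HodgeConjecture.Theorems.F0P3U3PrincipalSeriesOpenCellSigmaTwist  -- ★ p853773 (O2) FILE B (LH5-p05 (g13)): `exists_openCell_linearEquiv_weylTwist` ((B2)+(B4))
import HarnessLib

/-!
# (M5) — THE `hGL` LETTERS AT THE CM DATUM: `ℓ`, `θ : ℓ ≃ ℂ × ℂ`, `hθM`, `hθE` for the jet `i_B(χ ⊗ [[1,0],[λ,1]])` of `U(Φ₃)(L⁺_v)`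

Cell `pub/hodgecm-mathlib`, crux H413 = `stmt-HodgeConjecture-24833` (`--supports … --as helper`, THEOREMS ONLY).  Namespace
`Summit.HodgeConjecture.HodgeConjecture.Cruxes.H413.F0P3cStCharTSJetDatumHGL`.  E1 BRICK LEDGER (keeper F0P3a-p03 (g31) k23∕k24∕k63) «(M5) `exists_hGL_cmBorel`» — the ONE composite
the K4′ (O1) head `Theorems/F0P3cStCharTSK4PrimeJetIntertwiner.lean` (F0P2-p02 (g27); `hGL` TEXT v1 bd2c149c) reads at the datum: its letters `ℓ hℓ θ hθM hθE` for the lower-triangular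
jets `N₀ = χ₁ ⊗ [[1,0],[λ,1]]`, `N₀' = χ₁ ⊗ [[1,0],[−λ,1]]` of a continuous character `χ` of `T(L⁺_v)` and an additive-type `λ` vanishing on an open subgroup with `λ(ʷm) = −λ(m)`,
`χ(ʷm) = χ(m)` (the K4′ datum), PRODUCED from:
* FILE B `Theorems/F0P3U3PrincipalSeriesOpenCellSigmaTwist.lean` (LH5-p05 (g13), (O2)-B) at `σ := N₀`: the open-cell Haar functional `e : ℓ ≃ₗ[ℂ] (ℂ × ℂ)` with (B2) `e (r(m) x) = N₀(ʷm) (e x)`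
  and (B4) naturality `e (r(S) x) = U (e x)` for `S` over a linear `U` pointwise (`exists_openCell_linearEquiv_weylTwist`);
* ★ (O1)-D `unipotentModel_apply_weylConj_eq` (`N₀(ʷm) = N₀'(m)` from `χ^w = χ`, `λ^w = −λ`) and `exists_isOpen_forall_twist_unipotentModel_char_apply_eq_cm` (FILE B's per-vector
  open-fixer hypothesis `hσ` at `σ := N₀`);
* ★ (C) `evalJacquetKer` ∕ `mem_evalJacquetKer_iff` — the choice `ℓ := ker (ev₁ : r_B(i_B N₀) → N₀)`, with `δ_B|_N = 1` ★ `deltaChar_cmBorel_eq_one`.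
HONEST LABEL: count-neutral dock; K4′ = PAYDOWN-(J) road, rides when (O1)+(O2)+(O1)-D+(M5)+68 are ★ and the K4′-UNR head closes (rule 25∕26, LEAD F0P3a-plan); E1 = PRINT; h413 OPEN;
HC_CM is proved only modulo the 7 printed citations (2 remaining named inputs hLiu418 = stmt-HodgeConjecture-24832, h413 = stmt-HodgeConjecture-24833) until rung 0 closes.

## References
* [BernsteinZelevinsky1977] I. N. Bernstein, A. V. Zelevinsky, Ann. Sci. ÉNS 10 (1977), §1.9, §2.3, Geometrical Lemma 2.12.
* [Casselman1995] W. Casselman, *Introduction to the theory of admissible representations of `p`-adic reductive groups* (1995), §6.3, Lemma 7.1.1 (a).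
* [Keys1984] D. Keys, Compositio Math. 51 (1984), §3 pp. 118–119.  [Rogawski1990] J. Rogawski, Ann. of Math. Stud. 123 (1990), §12.2 (3) p. 173.
-/

set_option autoImplicit false
-- the mandated namespace has the single-problem summit's repeated segment (`HodgeConjecture.HodgeConjecture`)
set_option linter.dupNamespace false

noncomputable section

open NumberField IsDedekindDomain
open Literature.NumberTheory.Automorphic Literature.NumberTheory.Automorphic.UnitaryGroup Representation
open Summit.HodgeConjecture.HodgeConjecture.Cruxes.H413

namespace Summit.HodgeConjecture.HodgeConjecture.Cruxes.H413.F0P3cStCharTSJetDatumHGL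

/-! ## §1 Generic glue (any parabolic triple): the `hGL` letters from an open-cell isomorphism and the Weyl flip -/

section Generic

variable {G : Type*} [Group G] [TopologicalSpace G] [IsTopologicalGroup G] (t : ParabolicTriple G) [LocallyCompactSpace ↥t.P]
  {W : Type*} [AddCommGroup W] [Module ℂ W]
  (N₀ N₀' : Representation ℂ ↥t.M (W × W))

/-- **THE `hGL` LETTERS FROM AN OPEN-CELL ISOMORPHISM** (any parabolic triple; pure rewriting).  If `e : ℓ ≃ W × W` on a subspace `ℓ` of the Jacquet-module carrier of `i_t(N₀)`
intertwines `r(m)|_ℓ` with `N₀ (wm m)` (FILE B (B2) shape, `wm` the Weyl self-map of `M`) and is natural for `G`-maps `S` lying over a linear `U` pointwise (FILE B (B4) shape), and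
`N₀ (wm m) = N₀' m` (★ (O1)-D flip), then `θ := e` satisfies the (O1) head's `hθM` (`θ (r(m) x) = N₀' m (θ x)`) and `hθE` (`θ (r(S) x) = (0, (θ x).1)` for `S` over
`(w₁, w₂) ↦ (0, w₁)`). [cite: Casselman1995, Lemma 7.1.1 (a)] [cite: Keys1984, §3 pp. 118–119] -/
theorem hGL_of_openCell (wm : ↥t.M → ↥t.M) (hflip : ∀ m, N₀ (wm m) = N₀' m)
    (ℓ : Submodule ℂ (t.restrict (Representation.normalizedInd t N₀)).Coinvariants) (e : ↥ℓ ≃ₗ[ℂ] (W × W))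
    (heM : ∀ (m : ↥t.M) (x : (t.restrict (Representation.normalizedInd t N₀)).Coinvariants) (hx : x ∈ ℓ)
      (hmx : (Representation.normalizedInd t N₀).normalizedJacquet t m x ∈ ℓ),
      e ⟨(Representation.normalizedInd t N₀).normalizedJacquet t m x, hmx⟩ = N₀ (wm m) (e ⟨x, hx⟩))
    (heE : ∀ (S : (Representation.normalizedInd t N₀).IntertwiningMap (Representation.normalizedInd t N₀)) (U : (W × W) →ₗ[ℂ] (W × W)),
      (∀ (F : SmoothInd t.P (Representation.twist (N₀.comp t.proj) (rootDeltaChar t.P))) (g : G), (S F).toFun g = U (F.toFun g)) →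
      ∀ (x : (t.restrict (Representation.normalizedInd t N₀)).Coinvariants) (hx : x ∈ ℓ) (hSx : jacquetMap t S x ∈ ℓ),
        e ⟨jacquetMap t S x, hSx⟩ = U (e ⟨x, hx⟩)) :
    (∀ (m : ↥t.M) (x : (t.restrict (Representation.normalizedInd t N₀)).Coinvariants) (hx : x ∈ ℓ)
        (hmx : (Representation.normalizedInd t N₀).normalizedJacquet t m x ∈ ℓ),
        e ⟨(Representation.normalizedInd t N₀).normalizedJacquet t m x, hmx⟩ = N₀' m (e ⟨x, hx⟩)) ∧
      ∀ (S : (Representation.normalizedInd t N₀).IntertwiningMap (Representation.normalizedInd t N₀)),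
        (∀ (F : SmoothInd t.P (Representation.twist (N₀.comp t.proj) (rootDeltaChar t.P))) (x : G), (S F).toFun x = (0, (F.toFun x).1)) →
        ∀ (x : (t.restrict (Representation.normalizedInd t N₀)).Coinvariants) (hx : x ∈ ℓ) (hSx : jacquetMap t S x ∈ ℓ),
          e ⟨jacquetMap t S x, hSx⟩ = (0, (e ⟨x, hx⟩).1) := by
  refine ⟨fun m x hx hmx => by rw [heM m x hx hmx, hflip], fun S hS x hx hSx => ?_⟩
  have hU : ∀ (F : SmoothInd t.P (Representation.twist (N₀.comp t.proj) (rootDeltaChar t.P))) (g : G),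
      (S F).toFun g = ((LinearMap.inr ℂ W W).comp (LinearMap.fst ℂ W W)) (F.toFun g) := fun F g => by
    rw [hS F g]; rfl
  rw [heE S _ hU x hx hSx]
  rfl

end Generic

/-! ## §2 The CM datum -/

section Datum

variable (L : Type) [Field L] [NumberField L] [IsCMField L] (v : HeightOneSpectrum (𝓞 ↥(maximalRealSubfield L)))

set_option synthInstance.maxHeartbeats 400000 in
set_option maxHeartbeats 3200000 in
/-- **(M5) `hGLd_cmBorel` — THE BINDER `hGLd` OF ★ 68-H (SIGSHEET-68H :18–32) AT `t := cmBorelTriple L 3 v`, ITS BODY VERBATIM.**  For the Weyl element `w₀` (matrix `Φ₃`),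
a CONTINUOUS character `θ` of `T(L⁺_v)` read as `χL m x = θ(m)·x` with `θ(ʷm) = θ(m)` (the K4′ datum, `hθw`) and the sign flip `λ(ʷm) = −λ(m)` of EVERY additive `λ`
with open kernel (`hlamW`, the rank-one letter (L)): for every additive `λ` with `λ 1 = 0` and open kernel there are the jets `N₀ = χL ⊗ [[1,0],[λ,1]]`,
`N₀' = χL ⊗ [[1,0],[−λ,1]]` (★ `exists_representation_unipotentModel_jet`), the open-cell part `ℓ := ker ev₁ ≤ r_B(i_B N₀)` (★ (C)) with its membership description,
and FILE B's open-cell isomorphism `θ' : ℓ ≃ ℂ × ℂ` with `θ' (r(m) x) = N₀' m (θ' x)` (★ (O1)-D flip) and `θ' (r(S) x) = (0, (θ' x).1)` for every `G`-map `S` over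
`(w₁, w₂) ↦ (0, w₁)`.  Budgets (disclosed): `synthInstance.maxHeartbeats 400000` and ONE `maxHeartbeats 3200000` (16× default) on this single CM-carrier head —
the statement (the `hGLd` text of ★ 68-H) alone elaborates in ≈ 90 s; the proof names its witnesses with `choose` (an `obtain`∕`cases` step against this goal does not return
within 2·10⁷ heartbeats at the CM carrier — measured), whole file ≈ 125 s on the farm. [cite: Casselman1995, Lemma 7.1.1 (a) and §6.3]
[cite: BernsteinZelevinsky1977, Geometrical Lemma 2.12] [cite: Keys1984, §3 pp. 118–119] [cite: Rogawski1990, §12.2 (3) p. 173] -/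
theorem hGLd_cmBorel (hns : ∀ w : PlacesOver L v, IsCMField.complexConj L • w.1 = w.1)
    (w₀ : ↥(unitaryGroupOfForm (conjLocal L (IsCMField.complexConj L) v) (cmLocalForm L 3 v)))
    (hw₀ : Units.val (w₀ : GL (Fin 3) (LocalRing L v)) = cmLocalForm L 3 v)
    (θ : ↥(cmBorelTriple L 3 v).M →* ℂˣ) (hθc : Continuous fun x => ((θ x : ℂˣ) : ℂ))
    (χL : Representation ℂ ↥(cmBorelTriple L 3 v).M ℂ) (hχL : ∀ (m : ↥(cmBorelTriple L 3 v).M) (x : ℂ), χL m x = (θ m : ℂ) * x)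
    (hθw : ∀ m : ↥(cmBorelTriple L 3 v).M, θ ⟨w₀ * (m : ↥(unitaryGroupOfForm (conjLocal L (IsCMField.complexConj L) v) (cmLocalForm L 3 v))) * w₀⁻¹, weylConj_mem_cmTorus L v w₀ hw₀ m⟩ = θ m)
    (hlamW : ∀ lam : ↥(cmBorelTriple L 3 v).M → ℂ, lam 1 = 0 → (∀ m m' : ↥(cmBorelTriple L 3 v).M, lam (m * m') = lam m + lam m') →
      (∃ U : Subgroup ↥(cmBorelTriple L 3 v).M, IsOpen (U : Set ↥(cmBorelTriple L 3 v).M) ∧ ∀ m ∈ U, lam m = 0) →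
      ∀ m : ↥(cmBorelTriple L 3 v).M, lam ⟨w₀ * (m : ↥(unitaryGroupOfForm (conjLocal L (IsCMField.complexConj L) v) (cmLocalForm L 3 v))) * w₀⁻¹, weylConj_mem_cmTorus L v w₀ hw₀ m⟩ = -lam m) :
    haveI := locallyCompactSpace_cmBorelU L 3 v
    ∀ (lam : ↥(cmBorelTriple L 3 v).M → ℂ), lam 1 = 0 → (∀ m m' : ↥(cmBorelTriple L 3 v).M, lam (m * m') = lam m + lam m') →
      (∃ U : Subgroup ↥(cmBorelTriple L 3 v).M, IsOpen (U : Set ↥(cmBorelTriple L 3 v).M) ∧ ∀ m ∈ U, lam m = 0) →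
      ∃ (N₀ N₀' : Representation ℂ ↥(cmBorelTriple L 3 v).M (ℂ × ℂ))
        (ℓ : Submodule ℂ ((cmBorelTriple L 3 v).restrict (Representation.normalizedInd (cmBorelTriple L 3 v) N₀)).Coinvariants) (θ' : ↥ℓ ≃ₗ[ℂ] (ℂ × ℂ)),
        (∀ (m : ↥(cmBorelTriple L 3 v).M) (w : ℂ × ℂ), N₀ m w = (χL m w.1, lam m • χL m w.1 + χL m w.2)) ∧
        (∀ (m : ↥(cmBorelTriple L 3 v).M) (w : ℂ × ℂ), N₀' m w = (χL m w.1, (-lam m) • χL m w.1 + χL m w.2)) ∧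
        (∀ x, x ∈ ℓ ↔ ∃ f : Representation.SmoothInd (cmBorelTriple L 3 v).P (Representation.twist (N₀.comp (cmBorelTriple L 3 v).proj) (rootDeltaChar (cmBorelTriple L 3 v).P)),
          f.toFun 1 = 0 ∧ Representation.Coinvariants.mk ((cmBorelTriple L 3 v).restrict (Representation.normalizedInd (cmBorelTriple L 3 v) N₀)) f = x) ∧
        (∀ (m : ↥(cmBorelTriple L 3 v).M) (x : ((cmBorelTriple L 3 v).restrict (Representation.normalizedInd (cmBorelTriple L 3 v) N₀)).Coinvariants) (hx : x ∈ ℓ)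
          (hmx : (Representation.normalizedInd (cmBorelTriple L 3 v) N₀).normalizedJacquet (cmBorelTriple L 3 v) m x ∈ ℓ),
          θ' ⟨(Representation.normalizedInd (cmBorelTriple L 3 v) N₀).normalizedJacquet (cmBorelTriple L 3 v) m x, hmx⟩ = N₀' m (θ' ⟨x, hx⟩)) ∧
        (∀ (S : (Representation.normalizedInd (cmBorelTriple L 3 v) N₀).IntertwiningMap (Representation.normalizedInd (cmBorelTriple L 3 v) N₀)),
          (∀ (F : Representation.SmoothInd (cmBorelTriple L 3 v).P (Representation.twist (N₀.comp (cmBorelTriple L 3 v).proj) (rootDeltaChar (cmBorelTriple L 3 v).P))) (x : ↥(unitaryGroupOfForm (conjLocal L (IsCMField.complexConj L) v) (cmLocalForm L 3 v))), (S F).toFun x = (0, (F.toFun x).1)) →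
          ∀ (x : ((cmBorelTriple L 3 v).restrict (Representation.normalizedInd (cmBorelTriple L 3 v) N₀)).Coinvariants) (hx : x ∈ ℓ) (hSx : jacquetMap (cmBorelTriple L 3 v) S x ∈ ℓ),
            θ' ⟨jacquetMap (cmBorelTriple L 3 v) S x, hSx⟩ = (0, (θ' ⟨x, hx⟩).1)) := by
  haveI := locallyCompactSpace_cmBorelU L 3 v
  intro lam hlam1 hlam hopen
  -- the two jets (★ `exists_representation_unipotentModel_jet` at `χ := coeHom ∘ θ`, `λ` and `−λ`), read in `χL`'s letters; witnesses by `choose` (no `cases` on this goal)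
  have hj := @F0P3cStCharTSK2PiTwoSelfExtSplitSentence.exists_representation_unipotentModel_jet ℂ _ ↥(cmBorelTriple L 3 v).M _ ((Units.coeHom ℂ).comp θ) lam hlam1 hlam
  choose N₀ hN₀r using hj
  have hj' := @F0P3cStCharTSK2PiTwoSelfExtSplitSentence.exists_representation_unipotentModel_jet ℂ _ ↥(cmBorelTriple L 3 v).M _ ((Units.coeHom ℂ).comp θ) (fun m => -lam m)
    (by rw [hlam1, neg_zero]) (fun m m' => by rw [hlam, neg_add])
  choose N₀' hN₀r' using hj'
  have hN₀ : ∀ (m : ↥(cmBorelTriple L 3 v).M) (w : ℂ × ℂ), N₀ m w = (χL m w.1, lam m • χL m w.1 + χL m w.2) := fun m w => by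
    rw [hN₀r, hχL, hχL, smul_eq_mul]; rfl
  have hN₀' : ∀ (m : ↥(cmBorelTriple L 3 v).M) (w : ℂ × ℂ), N₀' m w = (χL m w.1, (-lam m) • χL m w.1 + χL m w.2) := fun m w => by
    rw [hN₀r', hχL, hχL, smul_eq_mul]; rfl
  -- the open-cell part `ℓ := ker ev₁` (★ (C)) with its membership description, and FILE B's open-fixer hypothesis at `σ := N₀` (★ (O1)-D), pre-typed
  have hℓ' : ∀ x, x ∈ F0P3U3PrincipalSeriesJacquetClosedCell.evalJacquetKer (cmBorelTriple L 3 v) N₀ (F0P2nBorelCharactersUnipotent.deltaChar_cmBorel_eq_one L v) ↔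
      ∃ f : SmoothInd (cmBorelTriple L 3 v).P (Representation.twist (N₀.comp (cmBorelTriple L 3 v).proj) (rootDeltaChar (cmBorelTriple L 3 v).P)),
        f.toFun 1 = 0 ∧ Coinvariants.mk ((cmBorelTriple L 3 v).restrict (Representation.normalizedInd (cmBorelTriple L 3 v) N₀)) f = x :=
    F0P3U3PrincipalSeriesJacquetClosedCell.mem_evalJacquetKer_iff (cmBorelTriple L 3 v) N₀ (F0P2nBorelCharactersUnipotent.deltaChar_cmBorel_eq_one L v)
  have hσ' : ∀ w : ℂ × ℂ, ∃ K : Subgroup ↥(unitaryGroupOfForm (conjLocal L (IsCMField.complexConj L) v) (cmLocalForm L 3 v)),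
      IsOpen (K : Set ↥(unitaryGroupOfForm (conjLocal L (IsCMField.complexConj L) v) (cmLocalForm L 3 v))) ∧
        ∀ b : ↥(cmBorelTriple L 3 v).P, (b : ↥(unitaryGroupOfForm (conjLocal L (IsCMField.complexConj L) v) (cmLocalForm L 3 v))) ∈ K →
          Representation.twist (N₀.comp (cmBorelTriple L 3 v).proj) (rootDeltaChar (cmBorelTriple L 3 v).P) b w = w := fun w =>
    F0P3cStCharTSJetDatumWeylDock.exists_isOpen_forall_twist_unipotentModel_char_apply_eq_cm L v θ hθc χL hχL lam hopen N₀ hN₀ w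
  -- FILE B (B2)+(B4) at `σ := N₀` on `W := ℂ × ℂ`
  have hB := F0P3U3PrincipalSeriesOpenCellSigmaTwist.exists_openCell_linearEquiv_weylTwist L v N₀ w₀ hw₀ hns hσ'
    (F0P3U3PrincipalSeriesJacquetClosedCell.evalJacquetKer (cmBorelTriple L 3 v) N₀ (F0P2nBorelCharactersUnipotent.deltaChar_cmBorel_eq_one L v)) hℓ'
  choose e heM heE using hB
  -- the Weyl flip `N₀(ʷm) = N₀'(m)` (★ (O1)-D), with `χL(ʷm) = χL(m)` from `θ(ʷm) = θ(m)` and `λ(ʷm) = −λ(m)` from `hlamW`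
  have hflip : ∀ m : ↥(cmBorelTriple L 3 v).M,
      N₀ ⟨w₀ * (m : ↥(unitaryGroupOfForm (conjLocal L (IsCMField.complexConj L) v) (cmLocalForm L 3 v))) * w₀⁻¹, weylConj_mem_cmTorus L v w₀ hw₀ m⟩ = N₀' m := by
    refine F0P3cStCharTSJetDatumWeylDock.unipotentModel_apply_weylConj_eq χL lam N₀ N₀' hN₀ hN₀'
      (fun m => ⟨w₀ * (m : ↥(unitaryGroupOfForm (conjLocal L (IsCMField.complexConj L) v) (cmLocalForm L 3 v))) * w₀⁻¹, weylConj_mem_cmTorus L v w₀ hw₀ m⟩)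
      (fun m => ?_) (hlamW lam hlam1 hlam hopen)
    refine LinearMap.ext fun x => ?_
    rw [hχL, hχL, hθw]
  exact ⟨N₀, N₀', _, e, hN₀, hN₀', hℓ', hGL_of_openCell (cmBorelTriple L 3 v) N₀ N₀'
    (fun m => ⟨w₀ * (m : ↥(unitaryGroupOfForm (conjLocal L (IsCMField.complexConj L) v) (cmLocalForm L 3 v))) * w₀⁻¹, weylConj_mem_cmTorus L v w₀ hw₀ m⟩) hflip
    (F0P3U3PrincipalSeriesJacquetClosedCell.evalJacquetKer (cmBorelTriple L 3 v) N₀ (F0P2nBorelCharactersUnipotent.deltaChar_cmBorel_eq_one L v)) e heM heE⟩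

end Datum

end Summit.HodgeConjecture.HodgeConjecture.Cruxes.H413.F0P3cStCharTSJetDatumHGL

end
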